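import Summits.BirchSwinnertonDyer.BirchSwinnertonDyer.Theorems.PrintX10bReadoutIndexOfLocalClauses
import Literature.NumberTheory.EllipticCurves.ZpExtensionEisensteinGradedPrincipalConditionProofs
import Literature.NumberTheory.EllipticCurves.ZpExtensionEisensteinOrdinaryCoreSaturationIndexProofs
import Literature.NumberTheory.GaloisCohomology.Howard2004.CondAComapIndexProofs
import Literature.NumberTheory.EllipticCurves.ZpExtensionEisensteinTwistLocalH1UniformCardProofs
import Literature.NumberTheory.EllipticCurves.AnticyclotomicHeegnerPlacesDecompositionProofs
import Literature.NumberTheory.EllipticCurves.AnticyclotomicInertiaAboveP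
import Literature.NumberTheory.EllipticCurves.IwasawaSelmerOrdinaryProofs
import Literature.NumberTheory.EllipticCurves.OrdinaryReductionAscentProofs
import Literature.NumberTheory.EllipticCurves.TorsionFilAtCyclicOfFrobeniusTraceProofs
import HarnessLib

/-!
# Letter (B5-P) `Stmt.readoutLocalIndexP` of `stub_readoutIndex` PROVED: at the places `v ∣ p` a relaxed, LEVEL-SHIFTED local
# condition `Fv` with `#(Fv ⧸ condA_j(v) ∩ Fv) ≤ p^{2p^s}`, uniformly in `m`, the tower level and the datum
# (helper for the shared μ-crux `MuInequalityCoherentPairOfPrintCG`, stmt-BirchSwinnertonDyer-23428; cell `pub/bsd-print-x9`,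
# seat `bsd-line-x10b-p1-w7` g3, S1-DISCRETE lane, ruling (3)/(4) of `bsd-line-x10b-p2` LEAD g8 22:46:37Z)

Summits-side helper, THEOREMS ONLY (no definition, no named fact, no instance, no `sorry`); ROUTE-INDEPENDENT (no `Theses`
import).  It discharges the second place-wise clause of `HeegnerMuPartControlGlue.readoutIndex_of_localClauses`
(x10b-p1-w2 g11, `Theorems/PrintX10bReadoutIndexOfLocalClauses`):
**`HeegnerMuPartControlGlue.stub_readoutLocalIndexP : Stmt.readoutLocalIndexP`**.

THE ARGUMENT (blueprint S1-DISCRETE §2, KER-RES-COUNT).  Fix `v ∣ p`; `E_K` has good ORDINARY reduction at `v` (`hyp.ordinary`,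
ordinary ascent), `v` is finitely decomposed in the anticyclotomic `K_∞` (Brink, Cor. 1), so some `σ_v ∈ Γ_{K_v}` has
`κ⁻¹(σ_v) = p^s` exactly — ONE `s` for all `v ∣ p` (finitely many places; raise to `p`-power).  Constants `c := 2 p^s`,
`m₁ := p^s + 1`, `j₀ := 0`.  At tower level `j` (twist level `j+1`) and shift `d` (x10b-p1-w6 g4's `d_v`, absorbing the classes of
the anomalous torsion `δ(Ẽ(k_{∞,w})[p^∞])`), with `n := j + d + 1`, `W_n = E_K[p^n] ⊗ A_{m,n}(ψ⁻¹)`, `Fil_v W_n`, `gr_v W_n = W_n / Fil_v W_n`: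
* `F′ ≤ H¹(K_v, W_n)` := the classes whose graded readout is PRINCIPAL on `res⁻¹(ker κ)` (this seat's
  `ZpExtension.OrdinaryFiltration.exists_addSubgroup_gradedPrincipal`, p676371): `F′ ⊇ core := ker gr_*` with
  `[F′ : core] ≤ #ker(H¹(K_v, gr) → H¹(K_{∞,w}, gr)) ≤ #H⁰ ≤ p^{p^s}` (p673740);
* `[core : core ∩ F_𝔮(v)_n] ≤ #H²(K_v, Fil_v W_n) ≤ p^{p^s}` (this seat's `WeierstrassCurve.natCard_ordinaryCore_quotient_levelCondition_le`,
  p675114, over p674121/p674702), `F_𝔮(v)_n = Tower.levelCondition …` being Howard's saturated ordinary condition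
  (`eisensteinDVRSetting_t_cond`, `eisensteinSelmerStructure_inr_of_mem`);
* `Fv := F′.comap (incLocIter j (inr v) d)`; since `condA_j(v) ⊇ F_𝔮(v)_{j+d}.comap (incLocIter j v d)`,
  `#(Fv ⧸ condA ∩ Fv) ≤ [F′ : F′ ∩ F_𝔮] ≤ [F′ : core]·[core : core ∩ F_𝔮] ≤ p^{2p^s}` (this seat's
  `AdicTower.finite_and_natCard_comap_incLocIter_quotient_condA_le`, p675869/p675601);
* `loc_v c ∈ Fv` for every class `c` whose readout is in `Sel_{p^∞}(E/K_∞)`: x10b-p1-w6 g4's (B5-P hS′)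
  `WeierstrassCurve.exists_quotient_cocycle_principal_of_eisensteinTowerReadout_mem_selmerInfty` (Greenberg strict = (CG) Kummer at
  `v ∣ p`, coboundary shift by `d_v` levels), read through the membership criterion of `F′`.
HONEST FRAMING: this is the `v ∣ p` clause of Howard's Lemma 2.2.7/3.2.7 at `𝔮 = T^m + p` with the honest `m`-UNIFORM count
(`#ker res`, `#H²(Fil)`) replacing «depending only on `[S_𝔮 : Λ/𝔮]`» — the printed bound `p^{a_v m}` is not `m`-uniform; the
level shift handles anomalous `v ∣ p`.  (B5-OFF)/(B5-BAD) are x9-p2 g6's and x10b-p2 LEAD g8's clauses.  «beyond-print theorem»: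
the `m`-uniformity is gap-filling, not a new theorem.  BSD is not proved by any of this; no summit statement is proved by this seat.

References: [Howard2004HeegnerKolyvagin] Lemma 2.2.7 / Prop. 2.2.8, Lemma 3.2.7, proof of Thm. 2.2.10 (arXiv:1202.6340 p. 16
L142–158, p. 17 L14–53, p. 18 L16–17); [GreenbergLNM1716] §2–§3 (pp. 62–75), §4 p. 98; [Brink2007] Cor. 1; [MilneADT2006] I Cor. 2.3;
[MazurRubinMemoirs2004] Lemma 3.7.1, Prop. 5.3.14.
-/

set_option linter.dupNamespace false
set_option autoImplicit false

noncomputable section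

open scoped Classical Pointwise ContRepresentation TensorProduct NumberField

open Function NumberField IsDedekindDomain Field
open Literature Literature.NumberTheory.EllipticCurves WeierstrassCurve
open Literature.NumberTheory.GaloisCohomology Literature.NumberTheory.GaloisCohomology.Howard2004
open Literature.NumberTheory.GaloisRepresentations Literature.NumberTheory.GaloisRepresentations.DiscreteGaloisModule
open Literature.NumberTheory.EllipticCurves.GreenbergSelmer
open Summit.BirchSwinnertonDyer.BirchSwinnertonDyer.Theorems
open Literature.NumberTheory.EllipticCurves.ZpExtension (EisensteinLevel)

namespace Summit.BirchSwinnertonDyer.BirchSwinnertonDyer.Theorems.HeegnerMuPartControlGlue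

/-! ## §1 One exponent for `κ` over the places above `p` -/

/-- **A uniform exponent over the places above `p`.**  If every place `v ∋ p` is finitely decomposed in `K_∞` (`¬ D_v ≤ ker κ`),
there is ONE `s` such that at every `v ∋ p` some `h_v ∈ Γ_{K_v}` has `κ(h_v) = p^s` exactly (finitely many places above `p`;
take the maximum local exponent and raise to a `p`-power).  [cite: SerreGaloisCohomology1997, I §1.4 (closed subgroups of ℤ_p)]
[cite: Brink2007, Cor. 1] -/
theorem exists_forall_toAdd_apply_absGaloisRestrict_eq_pow_of_mem {K : Type} [Field K] [NumberField K] {p : ℕ}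
    [hp : Fact p.Prime] (κ : ZpExtension K p)
    (hdec : ∀ v : HeightOneSpectrum (𝓞 K), ((p : ℕ) : 𝓞 K) ∈ v.asIdeal → ¬ (GreenbergSelmer.decomp v ≤ κ.kerSubgroup)) :
    ∃ s : ℕ, ∀ v : HeightOneSpectrum (𝓞 K), ((p : ℕ) : 𝓞 K) ∈ v.asIdeal →
      ∃ h : absoluteGaloisGroup (v.adicCompletion K),
        (κ (absGaloisRestrict K (v.adicCompletion K) h)).toAdd = ((p ^ s : ℕ) : ℤ_[p]) := by
  -- the finite set of places above `p`
  have hI : (Ideal.span {((p : ℕ) : 𝓞 K)} : Ideal (𝓞 K)) ≠ 0 := by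
    rw [Ne, Submodule.zero_eq_bot, Ideal.span_singleton_eq_bot]
    exact_mod_cast hp.out.ne_zero
  have hfin : {v : HeightOneSpectrum (𝓞 K) | ((p : ℕ) : 𝓞 K) ∈ v.asIdeal}.Finite := by
    refine (Ideal.finite_factors hI).subset fun v hv ↦ ?_
    exact (Ideal.dvd_span_singleton).2 hv
  -- a local exponent at each such place
  let ev : HeightOneSpectrum (𝓞 K) → ℕ := fun v ↦
    if hv : ((p : ℕ) : 𝓞 K) ∈ v.asIdeal then
      Classical.choose (κ.exists_toAdd_apply_absGaloisRestrict_adicCompletion_eq_pow v (hdec v hv))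
    else 0
  have hev : ∀ v, ∀ hv : ((p : ℕ) : 𝓞 K) ∈ v.asIdeal,
      ∃ h : absoluteGaloisGroup (v.adicCompletion K),
        (κ (absGaloisRestrict K (v.adicCompletion K) h)).toAdd = ((p ^ ev v : ℕ) : ℤ_[p]) := by
    intro v hv
    have hs := Classical.choose_spec (κ.exists_toAdd_apply_absGaloisRestrict_adicCompletion_eq_pow v (hdec v hv))
    simp only [ev, dif_pos hv]
    exact hs
  refine ⟨hfin.toFinset.sup ev, fun v hpv ↦ ?_⟩
  obtain ⟨h, hh⟩ := hev v hpv
  have hle : ev v ≤ hfin.toFinset.sup ev := Finset.le_sup (hfin.mem_toFinset.2 hpv)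
  refine ⟨h ^ p ^ (hfin.toFinset.sup ev - ev v), ?_⟩
  rw [map_pow, map_pow, toAdd_pow, hh, nsmul_eq_mul, ← Nat.cast_mul, ← pow_add, Nat.sub_add_cancel hle]

/-! ## §2 The per-place statement on Howard's tower of the curve (generic tower binders, St-free) -/

set_option maxHeartbeats 800000 in
/-- **(B5-P) at one place `v ∣ p` and one level `j`** on Howard's tower `T^{(k)} = E_K[p^{k+1}] ⊗ A_{m,k+1}(ψ⁻¹)`
(`W.eisensteinTower (κ.unitTwist (-1)) hm`, generic tower binders `π e hkill hker hπ he hπX hek`, any family of local conditions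
`F` which at `v` is Howard's saturated ordinary level condition `F_𝔮(v)`): given `σ₀ ∈ Γ_{K_v}` with `κ⁻¹(σ₀) = p^s`, `p^s < m`,
and the (hS′) input «for some shift `d`, Selmer readout ⇒ the `d`-shifted localisation has graded readout principal on
`res⁻¹(ker κ)`» (x10b-p1-w6 g4), the relaxed condition `Fv := F′.comap (incLocIter j (inr v) d)` contains `loc_v c` for every
such `c` and `#(Fv ⧸ condA F j v ∩ Fv) ≤ p^{2p^s}` (`[F′ : core] ≤ p^{p^s}` by `exists_addSubgroup_gradedPrincipal`,
`[core : core ∩ F_𝔮] ≤ p^{p^s}` by `natCard_ordinaryCore_quotient_levelCondition_le`, `condA ⊇ F_𝔮.comap` by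
`finite_and_natCard_comap_incLocIter_quotient_condA_le`).
[cite: Howard2004HeegnerKolyvagin, Lemma 2.2.7 / Prop. 2.2.8, Lemma 3.2.7 and proof of Thm. 2.2.10 (arXiv:1202.6340 p. 16–18)]
[cite: GreenbergLNM1716, §2–§3] [cite: MilneADT2006, I Cor. 2.3] -/
theorem readoutLocalIndexP_at {K : Type} [Field K] [NumberField K] (W : WeierstrassCurve ℚ) [W.IsElliptic]
    {p : ℕ} [hp : Fact p.Prime] (κ : ZpExtension K p) {m : ℕ} (hm : 1 ≤ m)
    (π : (IwasawaAlgebra p ⧸ Ideal.span {(PowerSeries.X ^ m + PowerSeries.C (p : ℤ_[p]) : IwasawaAlgebra p)})) (e : ℕ → ℕ)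
    (hkill : letI := IwasawaAlgebra.isLocalRing_quotient_X_pow_add_C p hm
      ∀ k, ∀ r ∈ IsLocalRing.maximalIdeal (IwasawaAlgebra p ⧸ Ideal.span {(PowerSeries.X ^ m + PowerSeries.C (p : ℤ_[p]) : IwasawaAlgebra p)}) ^ e k,
        ∀ x : EisensteinLevel p m (fun j ↦ geomTorsion (W.baseChange K) ((p : ℤ) ^ j)) (k + 1), r • x = 0)
    (hker : letI := IwasawaAlgebra.isLocalRing_quotient_X_pow_add_C p hm
      ∀ k, LinearMap.ker ((W.eisensteinTower (κ.unitTwist (-1)) hm).red k) =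
        (IsLocalRing.maximalIdeal (IwasawaAlgebra p ⧸ Ideal.span {(PowerSeries.X ^ m + PowerSeries.C (p : ℤ_[p]) : IwasawaAlgebra p)}) ^ e k) •
          (⊤ : Submodule (IwasawaAlgebra p ⧸ Ideal.span {(PowerSeries.X ^ m + PowerSeries.C (p : ℤ_[p]) : IwasawaAlgebra p)}) (EisensteinLevel p m (fun j ↦ geomTorsion (W.baseChange K) ((p : ℤ) ^ j)) (k + 1 + 1))))
    (hπ : letI := IwasawaAlgebra.isLocalRing_quotient_X_pow_add_C p hm
      π ∈ IsLocalRing.maximalIdeal (IwasawaAlgebra p ⧸ Ideal.span {(PowerSeries.X ^ m + PowerSeries.C (p : ℤ_[p]) : IwasawaAlgebra p)}))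
    (he : ∀ k, e k ≤ e (k + 1)) (hπX : π = Ideal.Quotient.mk _ PowerSeries.X) (hek : ∀ k, e (k + 1) - e k = m)
    (F : letI := IwasawaAlgebra.isLocalRing_quotient_X_pow_add_C p hm
      ∀ k, SelmerStructure ((W.eisensteinTower (κ.unitTwist (-1)) hm).ρ k))
    (v : HeightOneSpectrum (𝓞 K)) (hpv : ((p : ℕ) : 𝓞 K) ∈ v.asIdeal) (hgood : (W.baseChange K).HasGoodReductionAt v)
    (hord : ∃ P : localPoints (W.baseChange K) (v.adicCompletion K),
      (p : ℤ) • P = 0 ∧ P ∉ (W.baseChange K).localKernelOfReduction v)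
    (σ₀ : absoluteGaloisGroup (v.adicCompletion K)) {s : ℕ}
    (hσ₀ : ((κ.unitTwist (-1)) (absGaloisRestrict K (v.adicCompletion K) σ₀)).toAdd = ((p ^ s : ℕ) : ℤ_[p]))
    (hms : p ^ s < m) (j : ℕ)
    (hF : letI := IwasawaAlgebra.isLocalRing_quotient_X_pow_add_C p hm
      ∀ k, F k (Sum.inr v) = Tower.levelCondition ((κ.unitTwist (-1)).eisensteinLocalReduce (fun i ↦ (W.baseChange K).torsionGaloisModule ((p : ℤ) ^ i))
        (fun i ↦ (W.baseChange K).torsionGaloisModuleReduce p i) hm (Sum.inr v)) p (fun i ↦ ((W.baseChange K).ordinaryFiltrationAt v (fun i ↦ (W.baseChange K).torsionGaloisModuleReduce p i) (fun _ _ ↦ rfl)).ordinaryCore (κ := κ.unitTwist (-1)) hm i) (k + 1))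
    (hSv : letI := IwasawaAlgebra.isLocalRing_quotient_X_pow_add_C p hm
      ∃ d : ℕ, ∀ (k : ℕ) (c : galoisCohomology ((W.eisensteinTower (κ.unitTwist (-1)) hm).ρ k) 1),
        W.eisensteinTowerReadout κ hm π e hkill hker hπ he hπX hek
          (AddCommGroup.DirectLimit.of (fun k ↦ galoisCohomology ((W.eisensteinTower (κ.unitTwist (-1)) hm).ρ k) 1)
            (AdicTower.incH1LE (W.eisensteinTower (κ.unitTwist (-1)) hm) π e hkill hker hπ he) k c) ∈ (W.baseChange K).selmerInfty κ →
        ∃ φ : contOneCocycles ((GaloisRep.toLocal v ((κ.unitTwist (-1)).eisensteinTwist ((W.baseChange K).torsionGaloisModule ((p : ℤ) ^ (k + d + 1))) hm (k + d + 1))).quotient (((W.baseChange K).ordinaryFiltrationAt v (fun i ↦ (W.baseChange K).torsionGaloisModuleReduce p i) (fun _ _ ↦ rfl)).twistedFil (k + d + 1)) (((W.baseChange K).ordinaryFiltrationAt v (fun i ↦ (W.baseChange K).torsionGaloisModuleReduce p i) (fun _ _ ↦ rfl)).twistedFil_le_comap hm (k + d + 1))).toTopRep,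
          oneCocycleClass _ φ = DiscreteGaloisModule.quotientMap (GaloisRep.toLocal v ((κ.unitTwist (-1)).eisensteinTwist ((W.baseChange K).torsionGaloisModule ((p : ℤ) ^ (k + d + 1))) hm (k + d + 1)))
            (((W.baseChange K).ordinaryFiltrationAt v (fun i ↦ (W.baseChange K).torsionGaloisModuleReduce p i) (fun _ _ ↦ rfl)).twistedFil (k + d + 1)) (((W.baseChange K).ordinaryFiltrationAt v (fun i ↦ (W.baseChange K).torsionGaloisModuleReduce p i) (fun _ _ ↦ rfl)).twistedFil_le_comap hm (k + d + 1)) 1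
            (AdicTower.incLocIter (W.eisensteinTower (κ.unitTwist (-1)) hm) π e hkill hker hπ he k (Sum.inr v) d
              (galoisCohomology.localization ((W.eisensteinTower (κ.unitTwist (-1)) hm).ρ k) (Sum.inr v) 1 c)) ∧
          ∃ q₀ : IwasawaAlgebra.EisensteinCoeff.Twisted p m (k + d + 1) (geomTorsion (W.baseChange K) ((p : ℤ) ^ (k + d + 1))) ⧸
              ((W.baseChange K).ordinaryFiltrationAt v (fun i ↦ (W.baseChange K).torsionGaloisModuleReduce p i) (fun _ _ ↦ rfl)).twistedFil (k + d + 1),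
            ∀ σ : absoluteGaloisGroup (v.adicCompletion K), absGaloisRestrict K (v.adicCompletion K) σ ∈ κ.kerSubgroup →
              φ.1 σ = ((GaloisRep.toLocal v ((κ.unitTwist (-1)).eisensteinTwist ((W.baseChange K).torsionGaloisModule ((p : ℤ) ^ (k + d + 1))) hm (k + d + 1))).quotient (((W.baseChange K).ordinaryFiltrationAt v (fun i ↦ (W.baseChange K).torsionGaloisModuleReduce p i) (fun _ _ ↦ rfl)).twistedFil (k + d + 1)) (((W.baseChange K).ordinaryFiltrationAt v (fun i ↦ (W.baseChange K).torsionGaloisModuleReduce p i) (fun _ _ ↦ rfl)).twistedFil_le_comap hm (k + d + 1))) σ q₀ - q₀) :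
    letI := IwasawaAlgebra.isLocalRing_quotient_X_pow_add_C p hm
    ∃ Fv : AddSubgroup (galoisCohomology (((W.eisensteinTower (κ.unitTwist (-1)) hm).ρ j).toLocal (Sum.inr v)) 1),
      (∀ c : galoisCohomology ((W.eisensteinTower (κ.unitTwist (-1)) hm).ρ j) 1,
        W.eisensteinTowerReadout κ hm π e hkill hker hπ he hπX hek
          (AddCommGroup.DirectLimit.of (fun k ↦ galoisCohomology ((W.eisensteinTower (κ.unitTwist (-1)) hm).ρ k) 1)
            (AdicTower.incH1LE (W.eisensteinTower (κ.unitTwist (-1)) hm) π e hkill hker hπ he) j c) ∈ (W.baseChange K).selmerInfty κ →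
          galoisCohomology.localization ((W.eisensteinTower (κ.unitTwist (-1)) hm).ρ j) (Sum.inr v) 1 c ∈ Fv) ∧
      Finite (↥Fv ⧸ (AdicTower.condA (W.eisensteinTower (κ.unitTwist (-1)) hm) π e hkill hker hπ he F j (Sum.inr v)).addSubgroupOf Fv) ∧
      Nat.card (↥Fv ⧸ (AdicTower.condA (W.eisensteinTower (κ.unitTwist (-1)) hm) π e hkill hker hπ he F j (Sum.inr v)).addSubgroupOf Fv) ≤ p ^ (2 * p ^ s) := by
  letI := IwasawaAlgebra.isLocalRing_quotient_X_pow_add_C p hm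
  obtain ⟨d, hd⟩ := hSv
  -- finiteness of the level `n = j + d + 1`
  haveI hfinE : Finite (geomTorsion (W.baseChange K) ((p : ℤ) ^ (j + d + 1))) :=
    finite_torsionPoints_holds (W.baseChange K) (AlgebraicClosure K) (n := (p : ℤ) ^ (j + d + 1))
      (pow_ne_zero _ (by exact_mod_cast hp.out.ne_zero))
  haveI hfinM : Finite (IwasawaAlgebra.EisensteinCoeff.Twisted p m (j + d + 1)
      (geomTorsion (W.baseChange K) ((p : ℤ) ^ (j + d + 1)))) :=
    IwasawaAlgebra.EisensteinCoeff.finite_twisted (p := p) (k := j + d + 1)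
      (M := geomTorsion (W.baseChange K) ((p : ℤ) ^ (j + d + 1))) hm
  haveI hfinH := finite_galoisCohomology_one_toLocal ((κ.unitTwist (-1)).eisensteinTwist ((W.baseChange K).torsionGaloisModule ((p : ℤ) ^ (j + d + 1))) hm (j + d + 1)) v
  -- scalar data of `Γ_{K_v}` on `gr_v E_K[p^n]`
  obtain ⟨n₀, Q₀, hn₀, hσn, hQ₀⟩ := (W.baseChange K).exists_int_scalar_torsionFilAt v hgood hpv hord
    (k := j + d + 1) (Nat.le_add_left 1 (j + d)) σ₀
  -- (δ): the relaxed condition `F′ ⊇ core` at level `n`, `[F′ : core] ≤ p^{p^s}`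
  obtain ⟨F', hF', hcore, hfin₁, h₁⟩ :=
    ((W.baseChange K).ordinaryFiltrationAt v (fun i ↦ (W.baseChange K).torsionGaloisModuleReduce p i) (fun _ _ ↦ rfl)).exists_addSubgroup_gradedPrincipal (κ.unitTwist (-1)) hm (j + d + 1) σ₀ n₀ hn₀ hσn Q₀ hQ₀ hσ₀ hms
  -- (ε): `[core : core ∩ F_𝔮(v)_n] ≤ p^{p^s}`, `F_𝔮(v)_n = F (j + d) (inr v)` by `hF`
  have h₂ := (W.baseChange K).natCard_ordinaryCore_quotient_levelCondition_le (κ.unitTwist (-1)) hm v hgood hpv hord σ₀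
    hσ₀ hms (j + d + 1)
  rw [← hF (j + d)] at h₂
  haveI := hfin₁
  haveI hfin₂ : Finite (↥(((W.baseChange K).ordinaryFiltrationAt v (fun i ↦ (W.baseChange K).torsionGaloisModuleReduce p i) (fun _ _ ↦ rfl)).ordinaryCore (κ := κ.unitTwist (-1)) hm (j + d + 1)) ⧸
      (F (j + d) (Sum.inr v)).addSubgroupOf _) :=
    Finite.of_surjective _ QuotientAddGroup.mk_surjective
  -- (β): the shifted local index `#(Fv ⧸ condA ∩ Fv) ≤ p^{p^s} · p^{p^s}`, `Fv := F′.comap (incLocIter j (inr v) d)`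
  obtain ⟨hfin, hcard⟩ := @AdicTower.finite_and_natCard_comap_incLocIter_quotient_condA_le _ _ _ _ _ _ _ _ _ _ _ (W.eisensteinTower (κ.unitTwist (-1)) hm) π e
    hkill hker hπ he F j (Sum.inr v) d F' _ hcore hfin₁ hfin₂ (p ^ p ^ s) (p ^ p ^ s) h₁ h₂
  refine ⟨F'.comap (AdicTower.incLocIter (W.eisensteinTower (κ.unitTwist (-1)) hm) π e hkill hker hπ he j (Sum.inr v) d), fun c hc ↦ ?_, hfin,
    hcard.trans_eq ?_⟩
  · -- (hS′): Selmer readout ⇒ graded readout principal on `res⁻¹(ker κ)` after the shift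
    rw [AddSubgroup.mem_comap]
    refine (hF' _).2 ?_
    obtain ⟨φ, hφ, q₀, hq₀⟩ := hd j c hc
    exact ⟨φ, hφ, q₀, fun σ hσ ↦ hq₀ σ (by rwa [ZpExtension.kerSubgroup_unitTwist] at hσ)⟩
  · rw [two_mul, pow_add]

/-! ## §3 The letter (B5-P), conditional on the (hS′) input in x10b-p1-w6 g4's announced shape -/

set_option maxHeartbeats 1600000 in
set_option synthInstance.maxHeartbeats 80000 in
/-- **Letter (B5-P) `Stmt.readoutLocalIndexP` from the (hS′) input** (x10b-p1-w6 g4's announced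
`WeierstrassCurve.exists_quotient_cocycle_principal_of_eisensteinTowerReadout_mem_selmerInfty`, universally closed, taken as the
hypothesis `hP`): `c := 2 p^s`, `m₁ := p^s + 1`, `j₀ := 0` (`p^s` one exact value of `κ⁻¹ = κ.unitTwist (-1)` on `Γ_{K_v}` for
all `v ∣ p`, Brink Cor. 1 + `exists_forall_toAdd_apply_absGaloisRestrict_eq_pow_of_mem`); at `(j, v ∣ p)` the relaxed
condition is `readoutLocalIndexP_at`'s, the frame facts (good ordinary reduction at `v ∣ p`, the ordinary point, `p ∤ a_v`,
ramification of `K_∞` at `v`, finite decomposition) come from `Thm413Hypotheses` as in `PrintX10bStubReadoutSelmer` §1, and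
«`F_𝔮(v)` of the setting = the saturated ordinary level condition» is `eisensteinDVRSetting_t_cond` (`rfl`) with
`eisensteinSelmerStructure_inr_of_mem`.  The heartbeat budget pays for unifying the generic-tower statement of
`readoutLocalIndexP_at` with the letter's `eisensteinDVRSetting` projections (never re-elaborated here).
[cite: Howard2004HeegnerKolyvagin, Lemma 2.2.7 / Prop. 2.2.8, Lemma 3.2.7 and proof of Thm. 2.2.10 (𝔮 = T^m + p)]
[cite: GreenbergLNM1716, §2–§3] [cite: Brink2007, Cor. 1] [cite: MilneADT2006, I Cor. 2.3] -/
theorem stub_readoutLocalIndexP_of_principalShift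
    (hP : ∀ {K : Type} [Field K] [NumberField K] (W : WeierstrassCurve ℚ) [W.IsElliptic] {p : ℕ} [Fact p.Prime]
      (κ : ZpExtension K p) {m : ℕ} (hm : 1 ≤ m)
      (π : (IwasawaAlgebra p ⧸ Ideal.span {(PowerSeries.X ^ m + PowerSeries.C (p : ℤ_[p]) : IwasawaAlgebra p)})) (e : ℕ → ℕ)
      (hkill : letI := IwasawaAlgebra.isLocalRing_quotient_X_pow_add_C p hm
        ∀ k, ∀ r ∈ IsLocalRing.maximalIdeal (IwasawaAlgebra p ⧸ Ideal.span {(PowerSeries.X ^ m + PowerSeries.C (p : ℤ_[p]) : IwasawaAlgebra p)}) ^ e k,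
          ∀ x : EisensteinLevel p m (fun j ↦ geomTorsion (W.baseChange K) ((p : ℤ) ^ j)) (k + 1), r • x = 0)
      (hker : letI := IwasawaAlgebra.isLocalRing_quotient_X_pow_add_C p hm
        ∀ k, LinearMap.ker ((W.eisensteinTower (κ.unitTwist (-1)) hm).red k) =
          (IsLocalRing.maximalIdeal (IwasawaAlgebra p ⧸ Ideal.span {(PowerSeries.X ^ m + PowerSeries.C (p : ℤ_[p]) : IwasawaAlgebra p)}) ^ e k) •
            (⊤ : Submodule (IwasawaAlgebra p ⧸ Ideal.span {(PowerSeries.X ^ m + PowerSeries.C (p : ℤ_[p]) : IwasawaAlgebra p)}) (EisensteinLevel p m (fun j ↦ geomTorsion (W.baseChange K) ((p : ℤ) ^ j)) (k + 1 + 1))))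
      (hπ : letI := IwasawaAlgebra.isLocalRing_quotient_X_pow_add_C p hm
        π ∈ IsLocalRing.maximalIdeal (IwasawaAlgebra p ⧸ Ideal.span {(PowerSeries.X ^ m + PowerSeries.C (p : ℤ_[p]) : IwasawaAlgebra p)}))
      (he : ∀ k, e k ≤ e (k + 1)) (hπX : π = Ideal.Quotient.mk _ PowerSeries.X) (hek : ∀ k, e (k + 1) - e k = m)
      {γ : absoluteGaloisGroup K} (_hγ : κ.IsTopGenerator γ)
      (v : HeightOneSpectrum (𝓞 K)) (_hpv : ((p : ℕ) : 𝓞 K) ∈ v.asIdeal) (_hgood : (W.baseChange K).HasGoodReductionAt v)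
      (_hur : (W.baseChange K).HasUnitRootAt v)
      (_hord : ∃ P : localPoints (W.baseChange K) (v.adicCompletion K),
        (p : ℤ) • P = 0 ∧ P ∉ (W.baseChange K).localKernelOfReduction v)
      (_hram : ∃ 𝔓 ∈ v.primesAbove, ¬ 𝔓.inertia (absoluteGaloisGroup K) ≤ κ.kerSubgroup)
      (_hCG : Greenberg1999.imKummer_eq_strictCondition_goodOrdinary_numberField),
      letI := IwasawaAlgebra.isLocalRing_quotient_X_pow_add_C p hm
      ∃ d : ℕ, ∀ (k : ℕ) (c : galoisCohomology ((W.eisensteinTower (κ.unitTwist (-1)) hm).ρ k) 1),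
        W.eisensteinTowerReadout κ hm π e hkill hker hπ he hπX hek
          (AddCommGroup.DirectLimit.of (fun k ↦ galoisCohomology ((W.eisensteinTower (κ.unitTwist (-1)) hm).ρ k) 1)
            (AdicTower.incH1LE (W.eisensteinTower (κ.unitTwist (-1)) hm) π e hkill hker hπ he) k c) ∈ (W.baseChange K).selmerInfty κ →
        ∃ φ : contOneCocycles ((GaloisRep.toLocal v ((κ.unitTwist (-1)).eisensteinTwist ((W.baseChange K).torsionGaloisModule ((p : ℤ) ^ (k + d + 1))) hm (k + d + 1))).quotient (((W.baseChange K).ordinaryFiltrationAt v (fun i ↦ (W.baseChange K).torsionGaloisModuleReduce p i) (fun _ _ ↦ rfl)).twistedFil (k + d + 1)) (((W.baseChange K).ordinaryFiltrationAt v (fun i ↦ (W.baseChange K).torsionGaloisModuleReduce p i) (fun _ _ ↦ rfl)).twistedFil_le_comap hm (k + d + 1))).toTopRep,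
          oneCocycleClass _ φ = DiscreteGaloisModule.quotientMap (GaloisRep.toLocal v ((κ.unitTwist (-1)).eisensteinTwist ((W.baseChange K).torsionGaloisModule ((p : ℤ) ^ (k + d + 1))) hm (k + d + 1)))
            (((W.baseChange K).ordinaryFiltrationAt v (fun i ↦ (W.baseChange K).torsionGaloisModuleReduce p i) (fun _ _ ↦ rfl)).twistedFil (k + d + 1)) (((W.baseChange K).ordinaryFiltrationAt v (fun i ↦ (W.baseChange K).torsionGaloisModuleReduce p i) (fun _ _ ↦ rfl)).twistedFil_le_comap hm (k + d + 1)) 1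
            (AdicTower.incLocIter (W.eisensteinTower (κ.unitTwist (-1)) hm) π e hkill hker hπ he k (Sum.inr v) d
              (galoisCohomology.localization ((W.eisensteinTower (κ.unitTwist (-1)) hm).ρ k) (Sum.inr v) 1 c)) ∧
          ∃ q₀ : IwasawaAlgebra.EisensteinCoeff.Twisted p m (k + d + 1) (geomTorsion (W.baseChange K) ((p : ℤ) ^ (k + d + 1))) ⧸
              ((W.baseChange K).ordinaryFiltrationAt v (fun i ↦ (W.baseChange K).torsionGaloisModuleReduce p i) (fun _ _ ↦ rfl)).twistedFil (k + d + 1),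
            ∀ σ : absoluteGaloisGroup (v.adicCompletion K), absGaloisRestrict K (v.adicCompletion K) σ ∈ κ.kerSubgroup →
              φ.1 σ = ((GaloisRep.toLocal v ((κ.unitTwist (-1)).eisensteinTwist ((W.baseChange K).torsionGaloisModule ((p : ℤ) ^ (k + d + 1))) hm (k + d + 1))).quotient (((W.baseChange K).ordinaryFiltrationAt v (fun i ↦ (W.baseChange K).torsionGaloisModuleReduce p i) (fun _ _ ↦ rfl)).twistedFil (k + d + 1)) (((W.baseChange K).ordinaryFiltrationAt v (fun i ↦ (W.baseChange K).torsionGaloisModuleReduce p i) (fun _ _ ↦ rfl)).twistedFil_le_comap hm (k + d + 1))) σ q₀ - q₀) :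
    Stmt.readoutLocalIndexP := by
  intro hCG N _ W _ K _ _ p _ κ γ jbar hyp _hCM _hirr _hirrK _hsc _hHp _hhK
  haveI := hyp.isElliptic
  have hK : IsImaginaryQuadratic K := hyp.isImaginaryQuadratic
  -- every `v ∣ p` is finitely decomposed in `K_∞` (Brink), for `κ⁻¹ = κ.unitTwist (-1)`; one exponent `s` for all of them
  have hdec : ∀ v : HeightOneSpectrum (𝓞 K), ((p : ℕ) : 𝓞 K) ∈ v.asIdeal →
      ¬ (GreenbergSelmer.decomp v ≤ (κ.unitTwist (-1)).kerSubgroup) := fun v hpv ↦ by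
    rw [ZpExtension.kerSubgroup_unitTwist]
    exact ZpExtension.decomp_not_le_kerSubgroup_above_of_isAnticyclotomic_anyPrime K p hK κ hyp.anticyclotomic v hpv
  obtain ⟨s, hs⟩ := exists_forall_toAdd_apply_absGaloisRestrict_eq_pow_of_mem (κ.unitTwist (-1)) hdec
  -- the frame at `v ∣ p` from `Thm413Hypotheses` (stated before Howard's instance preamble): good reduction, `p ∤ a_v`,
  -- the ordinary point, ramification of `K_∞` at `v`
  have hgoodv : ∀ v : HeightOneSpectrum (𝓞 K), ((p : ℕ) : 𝓞 K) ∈ v.asIdeal → (W.baseChange K).HasGoodReductionAt v :=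
    fun v hpv ↦ W.hasGoodReductionAt_baseChange_of_hasGoodReductionAtPrime hyp.ordinary.1 v hpv
  have hurv : ∀ v : HeightOneSpectrum (𝓞 K), ((p : ℕ) : 𝓞 K) ∈ v.asIdeal → (W.baseChange K).HasUnitRootAt v := by
    intro v hpv
    rw [WeierstrassCurve.hasUnitRootAt_iff, WeierstrassCurve.ringChar_residueField_eq v (Fact.out : p.Prime) hpv]
    exact W.not_dvd_frobeniusTraceAt_baseChange_of_isOrdinaryAt hyp.ordinary v hpv
  have hordv : ∀ v : HeightOneSpectrum (𝓞 K), ((p : ℕ) : 𝓞 K) ∈ v.asIdeal →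
      ∃ P : localPoints (W.baseChange K) (v.adicCompletion K),
        (p : ℤ) • P = 0 ∧ P ∉ (W.baseChange K).localKernelOfReduction v :=
    fun v hpv ↦ (W.baseChange K).exists_ordinaryPoint_local_of_not_dvd_frobeniusTraceAt v (hgoodv v hpv) hpv
      (W.not_dvd_frobeniusTraceAt_baseChange_of_isOrdinaryAt hyp.ordinary v hpv)
  have hramv : ∀ v : HeightOneSpectrum (𝓞 K), ((p : ℕ) : 𝓞 K) ∈ v.asIdeal →
      ∃ 𝔓 ∈ v.primesAbove, ¬ 𝔓.inertia (absoluteGaloisGroup K) ≤ κ.kerSubgroup := fun v hpv ↦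
    ⟨adicCompletionPrime K v, adicCompletionPrime_mem_primesAbove K v,
      ZpExtension.inertia_not_le_kerSubgroup_of_isAnticyclotomic hK hyp.p_ne_two κ hyp.anticyclotomic hpv
        (adicCompletionPrime_mem_primesAbove K v)⟩
  refine ⟨2 * p ^ s, p ^ s + 1, fun m hm hm₁ ↦ ?_⟩
  letI := IwasawaAlgebra.isDomain_quotient_X_pow_add_C p hm
  letI := IwasawaAlgebra.isDiscreteValuationRing_quotient_X_pow_add_C p hm
  haveI := IwasawaAlgebra.EisensteinCoeff.isLocalRing_succ p hm
  letI := IwasawaAlgebra.EisensteinCoeff.algebraOfSpecSucc p m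
  haveI := W.isScalarTower_algebraOfSpecSucc (K := K) (p := p) (m := m)
  letI := W.residueModuleSucc (K := K) (p := p) hm
  intro S hpS hbad hSN hSσ L hL hLS jbar' cd Dd fs hy hπ he' hπX hek
  refine ⟨0, fun j _ v hvS hpv ↦ ?_⟩
  have hms : p ^ s < m := by omega
  obtain ⟨σ₀, hσ₀⟩ := hs v hpv
  -- the per-place statement on the setting's tower (`St.T = eisensteinTower`, `St.t_k.cond (inr v) = F_𝔮(v)_{k+1}` by `rfl`)
  refine readoutLocalIndexP_at W κ hm _ _ hy.killed hy.ker_red hπ he' hπX hek _ v hpv (hgoodv v hpv) (hordv v hpv) σ₀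
    hσ₀ hms j ?_ ?_
  · exact fun k ↦ (congrFun (W.eisensteinDVRSetting_t_cond (κ.unitTwist (-1)) hm S hpS hbad L hL hLS jbar' cd Dd fs k)
      (Sum.inr v)).trans (ZpExtension.eisensteinSelmerStructure_inr_of_mem _ _ _ _ _ _ _ hpv)
  · exact hP W κ hm _ _ hy.killed hy.ker_red hπ he' hπX hek hyp.topGenerator v hpv (hgoodv v hpv) (hurv v hpv)
      (hordv v hpv) (hramv v hpv) hCG

end Summit.BirchSwinnertonDyer.BirchSwinnertonDyer.Theorems.HeegnerMuPartControlGlue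

end
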